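import Summits.BirchSwinnertonDyer.Rank1Residual.GaloisImage.StarkVolumeContraction
import HarnessLib

/-!
# `Option`-indexed volume forms: contraction along an injection of index sets, and the cross product
# (pure linear algebra over a field; cell `b2b-bsdres`, team n1011, ROUTE-1 item R1-56 "S24(1) @
# m = 1 in the kernel", row T-R1-56-S, FILE C = K4a, part 3 of 3)

HONEST FRAMING (cell `b2b-bsdres`, verbatim): research route; prove what is provable now; no claim
beyond stated classes; nothing booked; no mark / label moved.  PURE LINEAR ALGEBRA over a field `k`
— no Galois cohomology, no arithmetic.  Theorems and (non-`Prop`) constructions only: no named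
fact, no conjecture node.

## What

The index sets of the consumer (`KolyvaginStalkExistence.lean`) are `Option N` for finite sets of
Kolyvagin primes `N` (the extra slot `none` is the free functional `g`), and the passage from a
level `N′` to a sub-level `N ⊆ N′` freezes the slots of `N′ ∖ N` at the transverse localisation
functionals.  This file specialises the slot restriction of parts 1–2 to that shape:
`VolumeForm.contract ω hj t` along an injection `j : ι ↪ ι′` (`contract_apply`, `contract_add`,
`contract_smul`), FUNCTORIAL in `j` (`contract_contract` — Mazur–Rubin JTNB 28 (2016) Prop. 6.2,
no sign since slots are indexed rather than ordered), carrying volume forms to volume forms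
(`contract_mem_volOn`), injective and onto between the lines of volume forms when the dimensions
match (`contract_ne_zero`, `contract_injOn`, `exists_contract_eq`).  Then the **cross product**
`VolumeForm.cross W ω φ ∈ W` of an `Option ι`-indexed volume form `ω` on `W` with a family
`φ : ι → Module.Dual k V` — the vector with `g (cross W ω φ) = ω (g, φ)` for every `g`
(`apply_cross`; Mazur–Rubin's regulator `Π_n`, op. cit. Def. 8.1, at rank one through
`W ≅ W^{**}`): killed by every `φ_i` (`apply_self_cross`), homogeneous in `ω` (`cross_smul`),
satisfying the SWAP identity `φ_i (cross W ω (φ[i ↦ ψ])) = −ψ (cross W ω φ)` (`apply_cross_update`;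
downstream the finite–singular relation of a Kolyvagin system, sign `(−1)^{ν(n)}` of op. cit.
Prop. 8.3), non-zero when `ω ≠ 0` and the `φ_i|_W` are independent (`cross_ne_zero`), and
compatible with contraction (`cross_contract`).

References: B. Mazur, K. Rubin, *Controlling Selmer groups in the higher core rank case*, J. Théor.
Nombres Bordeaux 28 (2016) 145–183 (= arXiv:1312.4052), Prop. 6.2, Def. 8.1, Prop. 8.3,
Appendix A (read 2026-08-21, held).
-/

noncomputable section

open Function Module

namespace Summit.BirchSwinnertonDyer.Rank1Residual.GaloisImage.VolumeForm

/-! ## §5. `Option`-indexed slots: the contraction along an injection of index sets -/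

section OptionSlots

variable {k : Type*} [Field k] {V : Type*} [AddCommGroup V] [Module k V] {ι ι' ι'' : Type*}

/-- A slot `s : Option ι′` off the range of `Option.map j` is `some b` with `b` off the range of
`j`. [folklore] -/
theorem eq_some_of_not_mem_range_optionMap {j : ι → ι'} {s : Option ι'}
    (hs : s ∉ Set.range (Option.map j)) : ∃ b, s = some b ∧ b ∉ Set.range j := by
  cases s with
  | none => exact absurd ⟨none, rfl⟩ hs
  | some b => exact ⟨b, rfl, fun ⟨a, ha⟩ => hs ⟨some a, by simp [ha]⟩⟩

/-- `some b` is off the range of `Option.map j` when `b` is off the range of `j`. [folklore] -/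
theorem some_not_mem_range_optionMap {j : ι → ι'} {b : ι'} (hb : b ∉ Set.range j) :
    (some b : Option ι') ∉ Set.range (Option.map j) := by
  rintro ⟨o, ho⟩
  cases o with
  | none => exact absurd ho (by simp)
  | some a => exact hb ⟨a, by simpa using ho⟩

/-- **The contraction along an injection of index sets** `j : ι ↪ ι′`: from `Option ι′`-indexed
forms to `Option ι`-indexed forms, the slot `none` and the slots `some (j a)` staying free and the
slots `some b`, `b ∉ range j`, frozen at `t b`.  Downstream: `ι = N ⊆ N′ = ι′` levels of a
Kolyvagin system, `t b` the transverse localisation functional at the prime `b`. [folklore] -/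
def contract (ω : (Module.Dual k V) [⋀^Option ι']→ₗ[k] k) {j : ι → ι'} (hj : Injective j)
    (t : ι' → Module.Dual k V) : (Module.Dual k V) [⋀^Option ι]→ₗ[k] k :=
  restrictSlots ω (Option.map_injective hj) (fun o => o.elim 0 t)

/-- The filled family of `contract`: slot `none` carries `x none`, slot `some b` carries
`Function.extend j (x ∘ some) t b`. [folklore] -/
theorem extend_optionMap_eq {j : ι → ι'} (hj : Injective j) (t : ι' → Module.Dual k V)
    (x : Option ι → Module.Dual k V) :
    Function.extend (Option.map j) x (fun o => o.elim 0 t) =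
      fun o => o.elim (x none) (Function.extend j (x ∘ some) t) := by
  funext o
  cases o with
  | none => exact (Option.map_injective hj).extend_apply x _ none
  | some b =>
    by_cases hb : ∃ a, j a = b
    · obtain ⟨a, rfl⟩ := hb
      rw [show (some (j a) : Option ι') = Option.map j (some a) from rfl,
        (Option.map_injective hj).extend_apply]
      change x (some a) = Function.extend j (x ∘ some) t (j a)
      rw [hj.extend_apply]; rfl
    · have hnot : ¬∃ o, Option.map j o = some b := by
        rintro ⟨o, ho⟩
        cases o with
        | none => exact absurd ho (by simp)
        | some a => exact hb ⟨a, by simpa using ho⟩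
      rw [extend_apply' _ _ _ hnot]
      change t b = Function.extend j (x ∘ some) t b
      rw [extend_apply' _ _ _ hb]

/-- Unfolding `contract`. [folklore] -/
theorem contract_apply (ω : (Module.Dual k V) [⋀^Option ι']→ₗ[k] k) {j : ι → ι'}
    (hj : Injective j) (t : ι' → Module.Dual k V) (x : Option ι → Module.Dual k V) :
    contract ω hj t x = ω (fun o => o.elim (x none) (Function.extend j (x ∘ some) t)) := by
  rw [contract, restrictSlots_apply, extend_optionMap_eq hj]

/-- `contract` is additive in the form. [folklore] -/
theorem contract_add (ω ω' : (Module.Dual k V) [⋀^Option ι']→ₗ[k] k) {j : ι → ι'}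
    (hj : Injective j) (t : ι' → Module.Dual k V) :
    contract (ω + ω') hj t = contract ω hj t + contract ω' hj t :=
  restrictSlots_add _ _ _ _

/-- `contract` is homogeneous in the form. [folklore] -/
theorem contract_smul (c : k) (ω : (Module.Dual k V) [⋀^Option ι']→ₗ[k] k) {j : ι → ι'}
    (hj : Injective j) (t : ι' → Module.Dual k V) :
    contract (c • ω) hj t = c • contract ω hj t :=
  restrictSlots_smul _ _ _ _

/-- **Functoriality of the contraction** along `ι ↪ ι′ ↪ ι″`: contracting in two steps (the inner
frozen values read through `j′`) is contracting in one (Mazur–Rubin JTNB 28 (2016) Prop. 6.2; no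
sign). [folklore] -/
theorem contract_contract (ω : (Module.Dual k V) [⋀^Option ι'']→ₗ[k] k) {j : ι → ι'}
    {j' : ι' → ι''} (hj : Injective j) (hj' : Injective j') (t : ι'' → Module.Dual k V) :
    contract (contract ω hj' t) hj (t ∘ j') = contract ω (hj'.comp hj) t := by
  ext y
  rw [contract_apply, contract_apply, contract_apply]
  congr 1
  funext o
  cases o with
  | none => rfl
  | some b =>
    change Function.extend j' (Function.extend j (y ∘ some) (t ∘ j')) t b =
      Function.extend (j' ∘ j) (y ∘ some) t b
    rw [extend_extend hj hj']

/-- The hypotheses of `restrictSlots_mem_volOn` / `restrictSlots_ne_zero` for the slots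
`Option.map j`, from their `ι′`-indexed forms. [folklore] -/
theorem optionSlots_hyp {j : ι → ι'} (t : ι' → Module.Dual k V) {P : Module.Dual k V → Prop}
    (h : ∀ b, b ∉ Set.range j → P (t b)) :
    ∀ s : Option ι', s ∉ Set.range (Option.map j) → P ((fun o : Option ι' => o.elim 0 t) s) := by
  intro s hs
  obtain ⟨b, rfl, hb⟩ := eq_some_of_not_mem_range_optionMap hs
  exact h b hb

/-- **The contraction carries volume forms on `W′` to volume forms on `W`** when a vector of `W′`
killed by every frozen `t b` (`b ∉ range j`) lies in `W`. [folklore] -/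
theorem contract_mem_volOn [Finite ι'] {W W' : Submodule k V}
    {ω : (Module.Dual k V) [⋀^Option ι']→ₗ[k] k} (hω : ω ∈ volOn (Option ι') W') {j : ι → ι'}
    (hj : Injective j) (t : ι' → Module.Dual k V)
    (hW : ∀ v ∈ W', (∀ b, b ∉ Set.range j → t b v = 0) → v ∈ W) :
    contract ω hj t ∈ volOn (Option ι) W :=
  restrictSlots_mem_volOn hω _ _ fun v hv hv' =>
    hW v hv fun b hb => hv' (some b) (some_not_mem_range_optionMap hb)

/-- **The contraction of a non-zero volume form is non-zero** when `#Option ι′ = dim W′`,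
`#Option ι = dim W`, `W ≤ W′`, every frozen `t b` kills `W`, and the frozen `t b` cut `W` out of
`W′`. [folklore] -/
theorem contract_ne_zero [Fintype ι] [Fintype ι'] [DecidableEq ι] [DecidableEq ι']
    {W W' : Submodule k V} [FiniteDimensional k W'] [FiniteDimensional k W]
    {ω : (Module.Dual k V) [⋀^Option ι']→ₗ[k] k} (hω : ω ∈ volOn (Option ι') W') (hω0 : ω ≠ 0)
    {j : ι → ι'} (hj : Injective j) (t : ι' → Module.Dual k V) (hWW' : W ≤ W')
    (hWt : ∀ b, b ∉ Set.range j → ∀ w ∈ W, t b w = 0)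
    (hW : ∀ v ∈ W', (∀ b, b ∉ Set.range j → t b v = 0) → v ∈ W)
    (hι' : Fintype.card (Option ι') = Module.finrank k W')
    (hι : Fintype.card (Option ι) = Module.finrank k W) :
    contract ω hj t ≠ 0 :=
  restrictSlots_ne_zero hω hω0 _ _ hWW' (optionSlots_hyp t (P := fun f => ∀ w ∈ W, f w = 0) hWt)
    (fun v hv hv' => hW v hv fun b hb => hv' (some b) (some_not_mem_range_optionMap hb)) hι' hι

/-- Two volume forms on `W′` with the same contraction are equal (hypotheses of
`contract_ne_zero`). [folklore] -/
theorem contract_injOn [Fintype ι] [Fintype ι'] [DecidableEq ι] [DecidableEq ι']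
    {W W' : Submodule k V} [FiniteDimensional k W'] [FiniteDimensional k W]
    {ω ω' : (Module.Dual k V) [⋀^Option ι']→ₗ[k] k} (hω : ω ∈ volOn (Option ι') W')
    (hω' : ω' ∈ volOn (Option ι') W') {j : ι → ι'} (hj : Injective j) (t : ι' → Module.Dual k V)
    (hWW' : W ≤ W') (hWt : ∀ b, b ∉ Set.range j → ∀ w ∈ W, t b w = 0)
    (hW : ∀ v ∈ W', (∀ b, b ∉ Set.range j → t b v = 0) → v ∈ W)
    (hι' : Fintype.card (Option ι') = Module.finrank k W')
    (hι : Fintype.card (Option ι) = Module.finrank k W)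
    (h : contract ω hj t = contract ω' hj t) : ω = ω' :=
  restrictSlots_injOn hω hω' _ _ hWW' (optionSlots_hyp t (P := fun f => ∀ w ∈ W, f w = 0) hWt)
    (fun v hv hv' => hW v hv fun b hb => hv' (some b) (some_not_mem_range_optionMap hb)) hι' hι h

/-- Every volume form on `W` is the contraction of one on `W′` (hypotheses of `contract_ne_zero`).
[folklore] -/
theorem exists_contract_eq [Fintype ι] [Fintype ι'] [DecidableEq ι] [DecidableEq ι']
    {W W' : Submodule k V} [FiniteDimensional k W'] [FiniteDimensional k W]
    {j : ι → ι'} (hj : Injective j) (t : ι' → Module.Dual k V)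
    (hWW' : W ≤ W') (hWt : ∀ b, b ∉ Set.range j → ∀ w ∈ W, t b w = 0)
    (hW : ∀ v ∈ W', (∀ b, b ∉ Set.range j → t b v = 0) → v ∈ W)
    (hι' : Fintype.card (Option ι') = Module.finrank k W')
    (hι : Fintype.card (Option ι) = Module.finrank k W)
    {ε : (Module.Dual k V) [⋀^Option ι]→ₗ[k] k} (hε : ε ∈ volOn (Option ι) W) :
    ∃ ω ∈ volOn (Option ι') W', contract ω hj t = ε :=
  exists_restrictSlots_eq _ _ hWW' (optionSlots_hyp t (P := fun f => ∀ w ∈ W, f w = 0) hWt)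
    (fun v hv hv' => hW v hv fun b hb => hv' (some b) (some_not_mem_range_optionMap hb)) hι' hι hε

end OptionSlots

/-! ## §6. The cross product of a volume form with a family of global functionals -/

section Cross

variable {k : Type*} [Field k] {V : Type*} [AddCommGroup V] [Module k V] {ι : Type*}

/-- The functional `g ↦ ω (g, φ)` on `Module.Dual k V` (slot `none` free, slots `some i` frozen at
`φ i`). [folklore] -/
def crossFunctional (ω : (Module.Dual k V) [⋀^Option ι]→ₗ[k] k) (φ : ι → Module.Dual k V) :
    Module.Dual k (Module.Dual k V) := by
  classical
  exact ω.toMultilinearMap.toLinearMap (fun o => o.elim 0 φ) none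

/-- Unfolding `crossFunctional`. [folklore] -/
@[simp] theorem crossFunctional_apply (ω : (Module.Dual k V) [⋀^Option ι]→ₗ[k] k)
    (φ : ι → Module.Dual k V) (g : Module.Dual k V) :
    crossFunctional ω φ g = ω (fun o => o.elim g φ) := by
  classical
  unfold crossFunctional
  rw [MultilinearMap.toLinearMap_apply]
  change ω _ = ω _
  congr 1
  funext o
  cases o with
  | none => simp
  | some i => simp

/-- **The cross product** `cross W ω φ ∈ W` of an `Option ι`-indexed form `ω` (intended: a volume
form on `W`) with a family `φ : ι → Module.Dual k V`: the vector of `W` on which every functional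
`g` takes the value `ω (g, φ)` (`apply_cross`) — Mazur–Rubin's regulator `Π_n` (JTNB 28 (2016)
Def. 8.1) at rank one, through `W ≅ W^{**}`. [folklore] -/
def cross (W : Submodule k V) [FiniteDimensional k W] (ω : (Module.Dual k V) [⋀^Option ι]→ₗ[k] k)
    (φ : ι → Module.Dual k V) : W :=
  (Module.evalEquiv k W).symm ((crossFunctional ω φ).comp (Subspace.dualLift W))

/-- **The defining property of the cross product**: `g (cross W ω φ) = ω (g, φ)` for every global
functional `g`, when `ω` is a volume form on `W`. [folklore] -/
theorem apply_cross {W : Submodule k V} [FiniteDimensional k W]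
    {ω : (Module.Dual k V) [⋀^Option ι]→ₗ[k] k} (hω : ω ∈ volOn (Option ι) W) [Fintype ι]
    (φ : ι → Module.Dual k V) (g : Module.Dual k V) :
    g (cross W ω φ : V) = ω (fun o => o.elim g φ) := by
  have h : W.dualRestrict g (cross W ω φ) =
      ((crossFunctional ω φ).comp (Subspace.dualLift W)) (W.dualRestrict g) := by
    rw [cross, Module.apply_evalEquiv_symm_apply]
  rw [Submodule.dualRestrict_apply] at h
  rw [h, LinearMap.comp_apply, crossFunctional_apply]
  refine apply_eq_of_forall_apply_eq hω fun o w hw => ?_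
  cases o with
  | none => simp only [Option.elim]; rw [Subspace.dualLift_of_mem hw, Submodule.dualRestrict_apply]
  | some i => rfl

/-- The cross product is killed by every frozen functional: `φ i (cross W ω φ) = 0` (two equal
slots). [folklore] -/
theorem apply_self_cross {W : Submodule k V} [FiniteDimensional k W]
    {ω : (Module.Dual k V) [⋀^Option ι]→ₗ[k] k} (hω : ω ∈ volOn (Option ι) W) [Fintype ι]
    (φ : ι → Module.Dual k V) (i : ι) : φ i (cross W ω φ : V) = 0 := by
  rw [apply_cross hω]
  exact ω.map_eq_zero_of_eq _ (i := none) (j := some i) rfl (Option.some_ne_none i).symm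

/-- The cross product is homogeneous in the form. [folklore] -/
theorem cross_smul {W : Submodule k V} [FiniteDimensional k W] (c : k)
    (ω : (Module.Dual k V) [⋀^Option ι]→ₗ[k] k) (φ : ι → Module.Dual k V) :
    cross W (c • ω) φ = c • cross W ω φ := by
  have h : crossFunctional (c • ω) φ = c • crossFunctional ω φ := by
    ext g; simp
  rw [cross, cross, h, LinearMap.smul_comp, LinearEquiv.map_smul]

/-- **The swap identity**: `φ i (cross W ω (φ[i ↦ ψ])) = −ψ (cross W ω φ)` — exchanging the free
slot `none` with the slot `some i` changes the sign (`AlternatingMap.map_swap`).  Downstream this is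
the finite–singular relation of the Kolyvagin system built from volume forms (Mazur–Rubin JTNB 28
(2016) Prop. 8.3, the sign `(−1)^{ν(n)}`). [folklore] -/
theorem apply_cross_update [DecidableEq ι] {W : Submodule k V} [FiniteDimensional k W]
    {ω : (Module.Dual k V) [⋀^Option ι]→ₗ[k] k} (hω : ω ∈ volOn (Option ι) W) [Fintype ι]
    (φ : ι → Module.Dual k V) (i : ι) (ψ : Module.Dual k V) :
    φ i (cross W ω (update φ i ψ) : V) = -ψ (cross W ω φ : V) := by
  rw [apply_cross hω, apply_cross hω]
  have h : (fun o : Option ι => o.elim (φ i) (update φ i ψ)) =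
      (fun o : Option ι => o.elim ψ φ) ∘ Equiv.swap none (some i) := by
    funext o
    cases o with
    | none => simp [Equiv.swap_apply_left]
    | some b =>
      by_cases hb : b = i
      · subst hb; simp [Equiv.swap_apply_right]
      · rw [Function.comp_apply, Equiv.swap_apply_of_ne_of_ne (Option.some_ne_none b)
          (fun h => hb (Option.some_injective _ h))]
        simp [hb]
  rw [h]
  exact ω.map_swap _ (Option.some_ne_none i).symm

/-- **Non-vanishing of the cross product**: if `ω ≠ 0` is a volume form on `W`
(`#Option ι = dim W`) and the frozen functionals are linearly independent on `W`, then
`cross W ω φ ≠ 0` — it then spans the line `W ∩ ⋂ ker φ_i`. [folklore] -/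
theorem cross_ne_zero [Fintype ι] [DecidableEq ι] {W : Submodule k V} [FiniteDimensional k W]
    {ω : (Module.Dual k V) [⋀^Option ι]→ₗ[k] k} (hω : ω ∈ volOn (Option ι) W) (hω0 : ω ≠ 0)
    (hι : Fintype.card (Option ι) = Module.finrank k W) {φ : ι → Module.Dual k V}
    (hφ : LinearIndependent k fun i => W.dualRestrict (φ i)) : cross W ω φ ≠ 0 := by
  classical
  -- the common kernel of the `φ_i` on `W` is a line: pick a non-zero vector `v₀` in it
  let Φ : Submodule k (Module.Dual k W) := Submodule.span k (Set.range fun i => W.dualRestrict (φ i))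
  have hΦ : Module.finrank k Φ = Fintype.card ι := finrank_span_eq_card hφ
  have hdim := Subspace.finrank_add_finrank_dualCoannihilator_eq Φ
  rw [hΦ, ← hι, Fintype.card_option] at hdim
  have hU : Module.finrank k Φ.dualCoannihilator = 1 := by omega
  obtain ⟨v₀, hv₀, hv₀0⟩ : ∃ v₀ ∈ Φ.dualCoannihilator, v₀ ≠ 0 := by
    by_contra h
    have : Φ.dualCoannihilator = ⊥ := by
      rw [Submodule.eq_bot_iff]
      intro v hv
      by_contra hv0
      exact h ⟨v, hv, hv0⟩
    rw [this, finrank_bot] at hU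
    exact zero_ne_one hU
  have hφv₀ : ∀ i, φ i (v₀ : V) = 0 := fun i => by
    have := (Submodule.mem_dualCoannihilator _).mp hv₀ _ (Submodule.subset_span ⟨i, rfl⟩)
    rwa [Submodule.dualRestrict_apply] at this
  -- a global functional not vanishing at `v₀`
  have hv₀V : (v₀ : V) ≠ 0 := fun h => hv₀0 (Subtype.ext h)
  obtain ⟨g, hg⟩ := Module.Projective.exists_dual_ne_zero k hv₀V
  -- the family `(g, φ)` restricted to `W` is linearly independent, so `ω` does not vanish on it
  suffices h : ω (fun o => o.elim g φ) ≠ 0 by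
    intro h0
    rw [← apply_cross hω φ g, h0] at h
    exact h (by simp)
  refine apply_ne_zero_of_linearIndependent hι hω hω0 ?_
  rw [Fintype.linearIndependent_iff]
  intro c hc
  -- evaluate the relation at `v₀`: the coefficient of `g` vanishes
  have hnone : c none = 0 := by
    have h := LinearMap.congr_fun hc v₀
    rw [Fintype.sum_option, LinearMap.zero_apply, LinearMap.add_apply, LinearMap.sum_apply,
      LinearMap.smul_apply, Submodule.dualRestrict_apply] at h
    simp only [Option.elim, LinearMap.smul_apply, Submodule.dualRestrict_apply, hφv₀,
      smul_eq_mul, mul_zero, Finset.sum_const_zero, add_zero] at h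
    exact (mul_eq_zero.mp h).resolve_right hg
  -- the rest is a relation among the `φ_i|_W`
  have hsome : ∀ i, c (some i) = 0 := by
    rw [Fintype.sum_option, hnone, zero_smul, zero_add] at hc
    exact Fintype.linearIndependent_iff.mp hφ (fun i => c (some i)) (by simpa using hc)
  intro o
  cases o with
  | none => exact hnone
  | some i => exact hsome i

/-- **The cross product commutes with contraction**: the cross product in `W` of the contracted
form with `φ` is the cross product in `W′` of the original form with `φ` extended by the frozen
functionals (both are characterised by the same values `ω (g, …)`). [folklore] -/
theorem cross_contract {ι' : Type*} [Fintype ι] [Fintype ι'] {W W' : Submodule k V}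
    [FiniteDimensional k W] [FiniteDimensional k W']
    {ω : (Module.Dual k V) [⋀^Option ι']→ₗ[k] k} (hω : ω ∈ volOn (Option ι') W') {j : ι → ι'}
    (hj : Injective j) (t : ι' → Module.Dual k V)
    (hc : contract ω hj t ∈ volOn (Option ι) W) (φ : ι → Module.Dual k V) :
    (cross W (contract ω hj t) φ : V) = cross W' ω (Function.extend j φ t) := by
  rw [← sub_eq_zero, ← Module.forall_dual_apply_eq_zero_iff k]
  intro g
  rw [map_sub, apply_cross hc, apply_cross hω, contract_apply, sub_eq_zero]
  rfl

end Cross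

end Summit.BirchSwinnertonDyer.Rank1Residual.GaloisImage.VolumeForm

end
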